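import Summits.QuantumFields.YangMills.Theorems.BalabanUVNodesN07FineBondByCoarsestFace
import Literature.MathematicalPhysics.QuantumFieldTheory.Balaban1983to89.B10StarCount
import HarnessLib

/-!
# DAG node N07 [B11] — THE CROSSING COUNT ALONG A STRAIGHT FINE PATH and the LAYER-CAKE SUM: the height of a fine bond's chain of crossed faces is the `L`-adic valuation of its label
# (`iterBlockOf i b₋ ≠ iterBlockOf i b₊ ⇔ Lⁱ ∣ v + 1`), along a straight fine path of `n` unit steps at most `n ∕ Lⁱ + 1` bonds cross a level-`i` face, hence with this base's per-fine-bond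
# letters (FILE 7) `Σ_{s<n} dist1 (U′ b_s) ≤ n·θ₀ + Σ_{i=1}^{k} (n ∕ Lⁱ + 1)·θ_i` — the summand of n07-w8 g5's variation door `dist1_toMS_path_le_sum` for the representative `U′`, print's
# «|U′_k(x,x′) − 1| < |x − y|·2L²ε₀» count ([B11] (145))

Cell `pub-ymgap` (HUMAN RULINGS D-0062 ∕ D-0088 ∕ D-0149), width seat `pub-ymgap-dag-n07-w6` (second wave), harness re-seat g0″, 2026-08-28; CLAIM-8 (own lineage FILE 7; n07-w8 g5 named the piece for
this lane in LOCATED-CRUDE-SHEAR-LETTER, n07-w5 g2 «yours»).  `--kind proof --supports stmt-QuantumFields-27364 --as helper` (K1⁹ per dag-lead KEY MAP v2; count-neutral).  THEOREMS ONLY.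

THE PRINT.  [B11] = [Balaban1985Variational] p. 301 (145) «|U′_k(x, x′) − 1| < |x − y|2L²ε₀ ≤ 4d(M + R₁M₁)L²… ≤ 8dL²Mε₀ for ⟨x, x′⟩ ⊂ □̃(k)»; [6] = [Balaban1985RegularSpaces] (1.15) p. 78, Lemma 1
(1.25) p. 79; [I] = [Balaban1987RG1] (0.3) p. 252 (`B^k(y)`: labels divided by `Lᵏ`).

WHAT THIS FILE DOES (integer bookkeeping + by-name composition; NOTHING of [B11]∕[6] analysis asserted).
* §1 CHAIN HEIGHT = `L`-ADIC VALUATION (generic `P`, fine bond `b`, `v := (b₋)_{dir b}` with `v + 1 < N₀`): `val_tgt_dir` ∕ `tgt_apply_ne` (the far end's labels), ★ `iterBlockOf_src_eq_tgt_iff`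
  (`i ≤ m + K`: `iterBlockOf i b₋ = iterBlockOf i b₊ ⇔ v ∕ Lⁱ = (v+1) ∕ Lⁱ`, lit `val_iterBlockOf`), ★ `iterBlockOf_src_ne_tgt_iff_dvd` (`⇔ Lⁱ ∣ v + 1`, `Nat.succ_div`), `cross_below_of_dvd` (`Lᵐ ∣ v+1 ⇒`
  every height `≤ m` is crossed), `stop_of_not_dvd`.
* §2 THE COUNT: ★ `card_filter_dvd_shift_le` — `#{s < n : q ∣ v₀ + s + 1} ≤ n ∕ q + 1` for `q ≥ 1` (`Nat.Ioc_filter_dvd_card_eq_div` on `(v₀, v₀ + n]`).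
* §3 THE LAYER-CAKE SUM: ★★ `sum_le_layerCake` — if `f s ≤ Σ_{i ≤ k, i = 0 ∨ Lⁱ ∣ v₀+s+1} θ_i` for `s < n` with `θ ≥ 0`, then `Σ_{s<n} f s ≤ n·θ₀ + Σ_{i<k} (n ∕ L^{i+1} + 1)·θ_{i+1}`.
* §5 FOLDING THE RUNS (n07-w8 g5's ask): `sum_div_le_sum_div` (`Σ_κ (a_κ ∕ q) ≤ (Σ a_κ) ∕ q`) and ★ `fold_runs_le` — the per-run bounds of `d` straight runs of lengths `n_κ` add up to
  `D₀·θ₀ + Σ_{i<k} (D₀ ∕ L^{i+1} + d)·θ_{i+1}`, `D₀ = Σ_κ n_κ` (the corner staircase of p613291's `box_reach`; the walk's decomposition into runs is the consumer's).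
* §4 ASSEMBLY WITH FILE 7 (any `U′`, windows nested under blocking up to the top `k ≤ m + K`, per-level plaquette letters `a_i`, within-block letters `τ_i`, top letter `v_k`; a straight fine path
  `b : ℕ → PBond (F.P K) 0` in direction `μ` with `((b s)₋)_μ = v₀ + s`, `v₀ + n + 1 ≤ N₀`, inside the bottom window): ★★ `dist1_fine_le_layer` — per bond, `dist1 (U′ (b s)) ≤ Σ_{i ≤ k, i = 0 ∨ Lⁱ ∣ v₀+s+1} θ_i`
  with `θ_i := τ_i + κ_i` (`i < k`, `κ_i := 7·((d+2)L)²∕4·a_i + (d+1)(L−1)·τ_i`), `θ_k := v_k` (FILE 7's `dist1_fine_le_of_coarsestFace` ∕ `…_of_top` at the valuation height); ★★★ `sum_dist1_fine_path_le` —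
  `Σ_{s<n} dist1 (U′ (b s)) ≤ n·θ₀ + Σ_{i<k} (n ∕ L^{i+1} + 1)·θ_{i+1}` (`1 ≤ k`).

HONEST FRAMING (binding).  Count-neutral helper; integer∕lattice bookkeeping + by-name composition of LANDED theorems (this base FILE 7 ∕ FILE 5, lit `B5Eq118OneStroke.val_iterBlockOf`, `B10StarCount.shift_apply_*`,
Mathlib `Nat.Ioc_filter_dvd_card_eq_div`); per-level letters, windows and the path are HYPOTHESES; the «≲ uniform in the height» evaluation of the right-hand side is the consumer's arithmetic, NOT typed here;
nothing of [B11]∕[6] analysis asserted; `stub_prop8StepCoP13` ∕ K0⁷ ∕ K1⁹ NOT closed; N07 NOT discharged; the chair's tally of record is the only count; **no summit statement is proved by this seat** —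
one finite `T⁴` programme at fixed `ε`, Bałaban AS PRINTED; the route closes the conditional finite-𝕋⁴ rung `BalabanLadder.UV` only; NOT continuum ∕ ℝ⁴ ∕ OS ∕ mass gap ∕ Clay.
No `sorry`, no `def`, no `instance`, no `notation`.
-/

noncomputable section

namespace Summit.QuantumFields.YangMills.BalabanUVNodes.N07FinePathCrossingCount

open scoped Matrix.Norms.L2Operator BigOperators
open Literature.MathematicalPhysics.QuantumFieldTheory.Balaban1983to89
open Literature.MathematicalPhysics.QuantumFieldTheory.Balaban1983to89.Node00
open T4Continuum
open B5Eq118OneStroke (iterBlockOf iterBlockOf_succ iterBlockOf_zero val_iterBlockOf)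
open ExpMeanLog (deltaSU)
open Summit.QuantumFields.YangMills.BalabanUVNodes.N07FineBondByCoarsestFace (dist1_fine_le_of_coarsestFace dist1_fine_le_of_top)

/-! ## §1  The chain height of a fine bond is the `L`-adic valuation of its label -/

section Valuation

variable {P : Params}

/-- The far end's label in the bond's direction is `v + 1` when the bond does not wrap (`v + 1 < N₀`). [cite: Balaban1987RG1, (0.1) p.251 (bookkeeping)] -/
theorem val_tgt_dir (b : PBond P 0) (hv : (b.src b.dir).val + 1 < P.sitesPerDir 0) : (b.tgt b.dir).val = (b.src b.dir).val + 1 := by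
  rw [PBond.tgt, B10StarCount.shift_apply_self, ZMod.val_add, ZMod.val_one, Nat.mod_eq_of_lt hv]

/-- The far end's other labels are unchanged. [cite: Balaban1987RG1, (0.1) p.251 (bookkeeping)] -/
theorem tgt_apply_ne (b : PBond P 0) {ν : Fin P.d} (hν : ν ≠ b.dir) : b.tgt ν = b.src ν := by
  rw [PBond.tgt, B10StarCount.shift_apply_ne _ hν]

/-- ★ **The two ends of a fine bond share their `i`-fold block point iff `v ∕ Lⁱ = (v + 1) ∕ Lⁱ`** (`v` the near end's label in the bond's direction, no wrap, `i ≤ m + K`; lit `val_iterBlockOf`: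
the labels of `Bⁱ` are the labels divided by `Lⁱ`). [cite: Balaban1987RG1, (0.3) p.252; Balaban1984PropagatorsI, (1.18) p.20] -/
theorem iterBlockOf_src_eq_tgt_iff (b : PBond P 0) (hv : (b.src b.dir).val + 1 < P.sitesPerDir 0) {i : ℕ} (hi : i ≤ P.m + P.K) :
    iterBlockOf i b.src = iterBlockOf i b.tgt ↔ (b.src b.dir).val / P.L ^ i = ((b.src b.dir).val + 1) / P.L ^ i := by
  constructor
  · intro h
    have h' : ((iterBlockOf i b.src) b.dir).val = ((iterBlockOf i b.tgt) b.dir).val := by rw [h]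
    rw [val_iterBlockOf i hi, val_iterBlockOf i hi, val_tgt_dir b hv] at h'
    exact h'
  · intro h
    funext ν
    apply ZMod.val_injective
    rw [val_iterBlockOf i hi, val_iterBlockOf i hi]
    by_cases hν : ν = b.dir
    · subst hν; rw [val_tgt_dir b hv]; exact h
    · rw [tgt_apply_ne b hν]

/-- ★ **CROSSING A LEVEL-`i` FACE ⇔ `Lⁱ ∣ v + 1`**: the `i`-fold block points of the two ends differ iff `Lⁱ` divides the far end's label (`Nat.succ_div`). [cite: Balaban1987RG1, (0.3) p.252] -/
theorem iterBlockOf_src_ne_tgt_iff_dvd (b : PBond P 0) (hv : (b.src b.dir).val + 1 < P.sitesPerDir 0) {i : ℕ} (hi : i ≤ P.m + P.K) :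
    iterBlockOf i b.src ≠ iterBlockOf i b.tgt ↔ P.L ^ i ∣ (b.src b.dir).val + 1 := by
  rw [Ne, iterBlockOf_src_eq_tgt_iff b hv hi, Nat.succ_div]
  by_cases h : P.L ^ i ∣ (b.src b.dir).val + 1
  · simp [h]
  · simp [h]

/-- `Lᵐ ∣ v + 1` ⇒ every face of height `i + 1 ≤ m` is crossed (FILE 7's `hcross` binder). [cite: Balaban1987RG1, (0.3) p.252 (bookkeeping)] -/
theorem cross_below_of_dvd (b : PBond P 0) (hv : (b.src b.dir).val + 1 < P.sitesPerDir 0) {m : ℕ} (hm : m ≤ P.m + P.K) (hdvd : P.L ^ m ∣ (b.src b.dir).val + 1) :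
    ∀ i < m, iterBlockOf (i + 1) b.src ≠ iterBlockOf (i + 1) b.tgt := fun i hi =>
  (iterBlockOf_src_ne_tgt_iff_dvd b hv (by omega)).2 ((pow_dvd_pow P.L (by omega : i + 1 ≤ m)).trans hdvd)

/-- `¬ Lᵐ⁺¹ ∣ v + 1` ⇒ the ends share their block point at height `m + 1` (FILE 7's `hstop` binder). [cite: Balaban1987RG1, (0.3) p.252 (bookkeeping)] -/
theorem stop_of_not_dvd (b : PBond P 0) (hv : (b.src b.dir).val + 1 < P.sitesPerDir 0) {m : ℕ} (hm : m + 1 ≤ P.m + P.K) (hnd : ¬ P.L ^ (m + 1) ∣ (b.src b.dir).val + 1) :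
    iterBlockOf (m + 1) b.src = iterBlockOf (m + 1) b.tgt := by
  by_contra h
  exact hnd ((iterBlockOf_src_ne_tgt_iff_dvd b hv hm).1 h)

end Valuation

/-! ## §2  The count of multiples along an interval -/

section Count

/-- ★ **Along `n` consecutive labels at most `n ∕ q + 1` are hit by the multiples of `q`**: `#{s < n : q ∣ v₀ + s + 1} ≤ n ∕ q + 1` (`q ≥ 1`; the multiples of `q` in `(v₀, v₀ + n]` number
`(v₀ + n) ∕ q − v₀ ∕ q`, Mathlib `Nat.Ioc_filter_dvd_card_eq_div`). [folklore] -/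
theorem card_filter_dvd_shift_le (q v₀ n : ℕ) (hq : 1 ≤ q) : ((Finset.range n).filter (fun s => q ∣ v₀ + s + 1)).card ≤ n / q + 1 := by
  -- inject `s ↦ v₀ + s + 1` into `Ioc v₀ (v₀ + n)`; the multiples there are those of `Ioc 0 (v₀+n)` minus those of `Ioc 0 v₀`
  have hinj : ((Finset.range n).filter (fun s => q ∣ v₀ + s + 1)).card =
      (((Finset.range n).filter (fun s => q ∣ v₀ + s + 1)).image (fun s => v₀ + s + 1)).card := by
    rw [Finset.card_image_of_injective _ (fun a b h => by simpa using h)]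
  have hsub : ((Finset.range n).filter (fun s => q ∣ v₀ + s + 1)).image (fun s => v₀ + s + 1) ⊆
      (Finset.Ioc 0 (v₀ + n)).filter (q ∣ ·) \ (Finset.Ioc 0 v₀).filter (q ∣ ·) := by
    intro t ht
    simp only [Finset.mem_image, Finset.mem_filter, Finset.mem_range] at ht
    obtain ⟨s, ⟨hs, hdvd⟩, rfl⟩ := ht
    simp only [Finset.mem_sdiff, Finset.mem_filter, Finset.mem_Ioc]
    refine ⟨⟨⟨by omega, by omega⟩, hdvd⟩, ?_⟩
    rintro ⟨⟨_, h2⟩, _⟩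
    omega
  have hcard := Finset.card_le_card hsub
  rw [← hinj] at hcard
  have h1 : ((Finset.Ioc 0 (v₀ + n)).filter (q ∣ ·)).card = (v₀ + n) / q := Nat.Ioc_filter_dvd_card_eq_div _ _
  have h2 : ((Finset.Ioc 0 v₀).filter (q ∣ ·)).card = v₀ / q := Nat.Ioc_filter_dvd_card_eq_div _ _
  have hsd : ((Finset.Ioc 0 (v₀ + n)).filter (q ∣ ·) \ (Finset.Ioc 0 v₀).filter (q ∣ ·)).card ≤ (v₀ + n) / q - v₀ / q := by
    have hsubset : (Finset.Ioc 0 v₀).filter (q ∣ ·) ⊆ (Finset.Ioc 0 (v₀ + n)).filter (q ∣ ·) := by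
      intro t ht
      simp only [Finset.mem_filter, Finset.mem_Ioc] at ht ⊢
      exact ⟨⟨ht.1.1, by omega⟩, ht.2⟩
    rw [Finset.card_sdiff, Finset.inter_eq_left.mpr hsubset, h1, h2]
  -- `(v₀ + n)/q − v₀/q ≤ n/q + 1`
  have hq0 : 0 < q := hq
  have hdiv : (v₀ + n) / q ≤ v₀ / q + n / q + 1 := by
    rw [Nat.add_div hq0]
    split_ifs <;> omega
  have hmono : v₀ / q ≤ (v₀ + n) / q := Nat.div_le_div_right (by omega)
  omega

end Count

/-! ## §3  The layer-cake sum -/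

section LayerCake

/-- ★★ **LAYER-CAKE**: if every term is bounded by the sum of the non-negative increments `θ_i` over the heights `i ≤ k` its label admits (`i = 0` always, `i ≥ 1` when `Lⁱ ∣ v₀ + s + 1`), then
`Σ_{s<n} f s ≤ n·θ₀ + Σ_{i<k} (n ∕ L^{i+1} + 1)·θ_{i+1}` — swap the sums and count with `card_filter_dvd_shift_le`. [folklore] -/
theorem sum_le_layerCake {L : ℕ} (hL : 1 ≤ L) (k v₀ n : ℕ) (θ : ℕ → ℝ) (hθ : ∀ i ≤ k, 0 ≤ θ i) (f : ℕ → ℝ)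
    (hf : ∀ s < n, f s ≤ ∑ i ∈ (Finset.range (k + 1)).filter (fun i => i = 0 ∨ L ^ i ∣ v₀ + s + 1), θ i) :
    ∑ s ∈ Finset.range n, f s ≤ (n : ℝ) * θ 0 + ∑ i ∈ Finset.range k, (((n / L ^ (i + 1) + 1 : ℕ)) : ℝ) * θ (i + 1) := by
  classical
  have hstep : ∑ s ∈ Finset.range n, f s ≤
      ∑ s ∈ Finset.range n, ∑ i ∈ (Finset.range (k + 1)).filter (fun i => i = 0 ∨ L ^ i ∣ v₀ + s + 1), θ i :=
    Finset.sum_le_sum fun s hs => hf s (Finset.mem_range.1 hs)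
  refine hstep.trans ?_
  have hind : ∀ s, ∑ i ∈ (Finset.range (k + 1)).filter (fun i => i = 0 ∨ L ^ i ∣ v₀ + s + 1), θ i =
      ∑ i ∈ Finset.range (k + 1), (if i = 0 ∨ L ^ i ∣ v₀ + s + 1 then θ i else 0) := fun s => by
    rw [Finset.sum_filter]
  simp_rw [hind]
  rw [Finset.sum_comm, Finset.sum_range_succ']
  -- height `0`: every `s` counts
  have h0 : ∑ s ∈ Finset.range n, (if (0 : ℕ) = 0 ∨ L ^ 0 ∣ v₀ + s + 1 then θ 0 else 0) = (n : ℝ) * θ 0 := by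
    simp
  rw [h0, add_comm]
  refine add_le_add le_rfl (Finset.sum_le_sum fun i hi => ?_)
  have hik : i + 1 ≤ k := by have := Finset.mem_range.1 hi; omega
  have hθi : 0 ≤ θ (i + 1) := hθ (i + 1) hik
  have hne : ∀ s, ((i + 1 = 0 ∨ L ^ (i + 1) ∣ v₀ + s + 1) ↔ L ^ (i + 1) ∣ v₀ + s + 1) := fun s => by simp
  simp_rw [hne]
  rw [← Finset.sum_filter, Finset.sum_const, nsmul_eq_mul]
  have hc := card_filter_dvd_shift_le (L ^ (i + 1)) v₀ n (Nat.one_le_pow _ _ hL)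
  exact mul_le_mul_of_nonneg_right (by exact_mod_cast hc) hθi

end LayerCake

/-! ## §4  Assembly with the per-fine-bond letters: the sum along a straight fine path -/

section Path

variable {F : T4Continuum.T4Family} {N : ℕ} [NeZero N] {K : ℕ}

/-- ★★ **THE PER-BOND LAYER BOUND**: in FILE 7's setting (any `U′`, windows nested under blocking up to the top `k ≤ m + K`, per-level letters `a_i, τ_i ≥ 0` with `((d+2)L)²∕4·a_i < δ_N`, plaquette and
within-block hypotheses over the windows, top letter `v_k` on the top window), a fine bond `b` with both ends in the bottom window, label `v = (b₋)_{dir b}` with `v + 1 < N₀`: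
`dist1 (U′ b) ≤ Σ_{i ≤ k, i = 0 ∨ Lⁱ ∣ v + 1} θ_i` with `θ_i := τ_i + κ_i` for `i < k` and `θ_k := v_k` — the chain stops at the `L`-adic valuation of `v + 1` (FILE 7's `…_of_coarsestFace`) or reaches
the top (`…_of_top`). [cite: Balaban1985Variational, (145) p.301; Balaban1985RegularSpaces, Lemma 1 (1.25) p.79] -/
theorem dist1_fine_le_layer {k : ℕ} (hk : k ≤ (F.P K).m + (F.P K).K) (U' : GaugeField (F.P K) 0 (SU N)) (W : ∀ i : ℕ, Set (Site (F.P K) i)) (a τ : ℕ → ℝ) {vk : ℝ}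
    (hnest : ∀ i < k, ∀ x : Site (F.P K) i, x ∈ W i → blockOf x ∈ W (i + 1))
    (ha : ∀ i < k, 0 ≤ a i) (hτ : ∀ i < k, 0 ≤ τ i) (hvk : 0 ≤ vk)
    (ht : ∀ i < k, (((((F.P K).d + 2) * (F.P K).L : ℕ) : ℝ) ^ 2 / 4) * a i < deltaSU (Fin N))
    (hplaq : ∀ i < k, ∀ c : PBond (F.P K) (i + 1), c.src ∈ W (i + 1) → c.tgt ∈ W (i + 1) → ∀ q : Plaq (F.P K) i,
      (blockOf q.src = c.src.unshift c.dir ∨ blockOf q.src = c.src ∨ blockOf q.src = c.tgt) → dist1 (GaugeField.plaqHol (Averaging.iter (avOfRecord F N K) i U') q) < a i)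
    (hint : ∀ i < k, ∀ b' : PBond (F.P K) i, blockOf b'.src = blockOf b'.tgt → blockOf b'.src ∈ W (i + 1) → dist1 (Averaging.iter (avOfRecord F N K) i U' b') ≤ τ i)
    (htop : ∀ c : PBond (F.P K) k, c.src ∈ W k → c.tgt ∈ W k → dist1 (Averaging.iter (avOfRecord F N K) k U' c) ≤ vk)
    (b : PBond (F.P K) 0) (hbs : b.src ∈ W 0) (hbt : b.tgt ∈ W 0) (hv : (b.src b.dir).val + 1 < (F.P K).sitesPerDir 0) :
    dist1 (U' b) ≤ ∑ i ∈ (Finset.range (k + 1)).filter (fun i => i = 0 ∨ (F.P K).L ^ i ∣ (b.src b.dir).val + 1),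
      (if i < k then τ i + (7 * ((((((F.P K).d + 2) * (F.P K).L : ℕ) : ℝ) ^ 2 / 4) * a i) + ((((F.P K).d + 1) * ((F.P K).L - 1) : ℕ) : ℝ) * τ i) else vk) := by
  classical
  have hκ0 : ∀ i < k, 0 ≤ (7 * ((((((F.P K).d + 2) * (F.P K).L : ℕ) : ℝ) ^ 2 / 4) * a i) + ((((F.P K).d + 1) * ((F.P K).L - 1) : ℕ) : ℝ) * τ i) := fun i hi => by
    have := ha i hi; have := hτ i hi; positivity
  -- the height of the chain: the largest `m ≤ k` with `L^m ∣ v + 1`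
  set v := (b.src b.dir).val with hvdef
  have hL1 : 1 ≤ (F.P K).L := (F.P K).L_pos
  -- the set of admissible heights
  set H : Finset ℕ := (Finset.range (k + 1)).filter (fun i => i = 0 ∨ (F.P K).L ^ i ∣ v + 1) with hH
  have h0H : 0 ∈ H := by simp [hH]
  -- `H` is downward closed among `i ≥ 0`: if `i ∈ H` and `i' ≤ i` then `i' ∈ H`
  have hdown : ∀ i ∈ H, ∀ i' ≤ i, i' ∈ H := by
    intro i hi i' hi'
    simp only [hH, Finset.mem_filter, Finset.mem_range] at hi ⊢
    refine ⟨by omega, ?_⟩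
    rcases Nat.eq_zero_or_pos i' with h | h
    · exact Or.inl h
    · right
      rcases hi.2 with h0 | hd
      · omega
      · exact (pow_dvd_pow _ hi').trans hd
  -- the maximum `m` of `H`
  obtain ⟨m, hmH, hmax⟩ := H.exists_max_image id ⟨0, h0H⟩
  have hmk : m ≤ k := by have := (Finset.mem_filter.1 hmH).1; rw [Finset.mem_range] at this; omega
  -- all heights `≤ m` are crossed
  have hcross : ∀ i < m, iterBlockOf (i + 1) b.src ≠ iterBlockOf (i + 1) b.tgt := by
    rcases Nat.eq_zero_or_pos m with hm0 | hm0
    · intro i hi; omega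
    · have hdvd : (F.P K).L ^ m ∣ v + 1 := by
        rcases (Finset.mem_filter.1 hmH).2 with h | h
        · omega
        · exact h
      exact cross_below_of_dvd b hv (hmk.trans hk) hdvd
  -- the nonnegative total over `H` dominates the partial sum up to `m`
  have hsumθ : (∑ i ∈ Finset.range m, (7 * ((((((F.P K).d + 2) * (F.P K).L : ℕ) : ℝ) ^ 2 / 4) * a i) + ((((F.P K).d + 1) * ((F.P K).L - 1) : ℕ) : ℝ) * τ i)) + (if m < k then τ m + (7 * ((((((F.P K).d + 2) * (F.P K).L : ℕ) : ℝ) ^ 2 / 4) * a m) + ((((F.P K).d + 1) * ((F.P K).L - 1) : ℕ) : ℝ) * τ m) else vk) ≤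
      ∑ i ∈ H, (if i < k then τ i + (7 * ((((((F.P K).d + 2) * (F.P K).L : ℕ) : ℝ) ^ 2 / 4) * a i) + ((((F.P K).d + 1) * ((F.P K).L - 1) : ℕ) : ℝ) * τ i) else vk) := by
    -- `range (m+1) ⊆ H`, terms nonnegative
    have hsub : Finset.range (m + 1) ⊆ H := fun i hi => hdown m hmH i (by rw [Finset.mem_range] at hi; omega)
    have hnn : ∀ i ∈ H, 0 ≤ (if i < k then τ i + (7 * ((((((F.P K).d + 2) * (F.P K).L : ℕ) : ℝ) ^ 2 / 4) * a i) + ((((F.P K).d + 1) * ((F.P K).L - 1) : ℕ) : ℝ) * τ i) else vk) := by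
      intro i hi
      split_ifs with hik
      · exact add_nonneg (hτ i hik) (hκ0 i hik)
      · exact hvk
    calc (∑ i ∈ Finset.range m, (7 * ((((((F.P K).d + 2) * (F.P K).L : ℕ) : ℝ) ^ 2 / 4) * a i) + ((((F.P K).d + 1) * ((F.P K).L - 1) : ℕ) : ℝ) * τ i)) + (if m < k then τ m + (7 * ((((((F.P K).d + 2) * (F.P K).L : ℕ) : ℝ) ^ 2 / 4) * a m) + ((((F.P K).d + 1) * ((F.P K).L - 1) : ℕ) : ℝ) * τ m) else vk)
        ≤ ∑ i ∈ Finset.range (m + 1), (if i < k then τ i + (7 * ((((((F.P K).d + 2) * (F.P K).L : ℕ) : ℝ) ^ 2 / 4) * a i) + ((((F.P K).d + 1) * ((F.P K).L - 1) : ℕ) : ℝ) * τ i) else vk) := by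
          rw [Finset.sum_range_succ]
          refine add_le_add ?_ le_rfl
          refine Finset.sum_le_sum fun i hi => ?_
          have him : i < m := Finset.mem_range.1 hi
          have hik : i < k := by omega
          rw [if_pos hik]
          linarith [hτ i hik]
      _ ≤ ∑ i ∈ H, (if i < k then τ i + (7 * ((((((F.P K).d + 2) * (F.P K).L : ℕ) : ℝ) ^ 2 / 4) * a i) + ((((F.P K).d + 1) * ((F.P K).L - 1) : ℕ) : ℝ) * τ i) else vk) := Finset.sum_le_sum_of_subset_of_nonneg hsub (fun i hi _ => hnn i hi)
  refine le_trans ?_ hsumθ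
  -- the two terminations
  by_cases hmk' : m < k
  · -- stop at height `m + 1`: `¬ L^{m+1} ∣ v + 1` (else `m + 1 ∈ H`, contradicting maximality)
    have hnd : ¬ (F.P K).L ^ (m + 1) ∣ v + 1 := by
      intro hd
      have : m + 1 ∈ H := by
        simp only [hH, Finset.mem_filter, Finset.mem_range]
        exact ⟨by omega, Or.inr hd⟩
      have := hmax (m + 1) this
      simp at this
    have hstop := stop_of_not_dvd b hv (by omega) hnd
    have hfile7 := dist1_fine_le_of_coarsestFace U' W a τ b hbs hbt (m := m) (by omega) (fun i hi => hnest i (by omega))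
      (fun i hi => ha i (by omega)) (fun i hi => hτ i (by omega)) (fun i hi => ht i (by omega)) (fun i hi => hplaq i (by omega))
      (fun i hi => hint i (by omega)) hcross hstop
    rw [if_pos hmk']
    have hκm := hκ0 m hmk'
    linarith [hfile7]
  · -- reach the top: `m = k`
    have hmk'' : m = k := le_antisymm hmk (not_lt.1 hmk')
    subst hmk''
    have hfile7 := dist1_fine_le_of_top U' W a τ b hbs hbt hk hnest ha hτ ht hplaq hint hcross htop
    rw [if_neg (lt_irrefl _)]
    linarith [hfile7]

/-- ★★★ **THE SUM ALONG A STRAIGHT FINE PATH**: in the setting of `dist1_fine_le_layer` with `1 ≤ k`, for a straight fine path `b : ℕ → PBond` in direction `μ` (`(b s).dir = μ`,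
`((b s)₋)_μ = v₀ + s` for `s < n`, no wrap `v₀ + n + 1 ≤ N₀`, every bond with both ends in the bottom window):
`Σ_{s<n} dist1 (U′ (b s)) ≤ n·θ₀ + Σ_{i<k} (n ∕ L^{i+1} + 1)·θ_{i+1}`, `θ_i := τ_i + κ_i` (`i < k`), `θ_k := v_k` — the summand for n07-w8 g5's `dist1_toMS_path_le_sum`. [cite: Balaban1985Variational, (145) p.301] -/
theorem sum_dist1_fine_path_le {k : ℕ} (hk1 : 1 ≤ k) (hk : k ≤ (F.P K).m + (F.P K).K) (U' : GaugeField (F.P K) 0 (SU N)) (W : ∀ i : ℕ, Set (Site (F.P K) i)) (a τ : ℕ → ℝ) {vk : ℝ}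
    (hnest : ∀ i < k, ∀ x : Site (F.P K) i, x ∈ W i → blockOf x ∈ W (i + 1))
    (ha : ∀ i < k, 0 ≤ a i) (hτ : ∀ i < k, 0 ≤ τ i) (hvk : 0 ≤ vk)
    (ht : ∀ i < k, (((((F.P K).d + 2) * (F.P K).L : ℕ) : ℝ) ^ 2 / 4) * a i < deltaSU (Fin N))
    (hplaq : ∀ i < k, ∀ c : PBond (F.P K) (i + 1), c.src ∈ W (i + 1) → c.tgt ∈ W (i + 1) → ∀ q : Plaq (F.P K) i,
      (blockOf q.src = c.src.unshift c.dir ∨ blockOf q.src = c.src ∨ blockOf q.src = c.tgt) → dist1 (GaugeField.plaqHol (Averaging.iter (avOfRecord F N K) i U') q) < a i)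
    (hint : ∀ i < k, ∀ b' : PBond (F.P K) i, blockOf b'.src = blockOf b'.tgt → blockOf b'.src ∈ W (i + 1) → dist1 (Averaging.iter (avOfRecord F N K) i U' b') ≤ τ i)
    (htop : ∀ c : PBond (F.P K) k, c.src ∈ W k → c.tgt ∈ W k → dist1 (Averaging.iter (avOfRecord F N K) k U' c) ≤ vk)
    (b : ℕ → PBond (F.P K) 0) {μ : Fin (F.P K).d} {v₀ n : ℕ} (hdir : ∀ s < n, (b s).dir = μ) (hval : ∀ s < n, ((b s).src μ).val = v₀ + s)
    (hwrap : v₀ + n + 1 ≤ (F.P K).sitesPerDir 0) (hbW : ∀ s < n, (b s).src ∈ W 0 ∧ (b s).tgt ∈ W 0) :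
    ∑ s ∈ Finset.range n, dist1 (U' (b s)) ≤
      (n : ℝ) * (τ 0 + (7 * ((((((F.P K).d + 2) * (F.P K).L : ℕ) : ℝ) ^ 2 / 4) * a 0) + ((((F.P K).d + 1) * ((F.P K).L - 1) : ℕ) : ℝ) * τ 0)) +
        ∑ i ∈ Finset.range k, (((n / (F.P K).L ^ (i + 1) + 1 : ℕ)) : ℝ) *
          (if i + 1 < k then τ (i + 1) + (7 * ((((((F.P K).d + 2) * (F.P K).L : ℕ) : ℝ) ^ 2 / 4) * a (i + 1)) + ((((F.P K).d + 1) * ((F.P K).L - 1) : ℕ) : ℝ) * τ (i + 1))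
            else vk) := by
  classical
  set θ : ℕ → ℝ := fun i => if i < k then τ i + (7 * ((((((F.P K).d + 2) * (F.P K).L : ℕ) : ℝ) ^ 2 / 4) * a i) + ((((F.P K).d + 1) * ((F.P K).L - 1) : ℕ) : ℝ) * τ i) else vk
    with hθdef
  have hθ : ∀ i ≤ k, 0 ≤ θ i := by
    intro i hi
    simp only [hθdef]
    split_ifs with hik
    · have := ha i hik; have := hτ i hik; positivity
    · exact hvk
  have hmain := sum_le_layerCake (F.P K).L_pos k v₀ n θ hθ (fun s => dist1 (U' (b s))) (fun s hs => by
    have hb := hbW s hs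
    have hv : ((b s).src (b s).dir).val + 1 < (F.P K).sitesPerDir 0 := by rw [hdir s hs, hval s hs]; omega
    have h := dist1_fine_le_layer hk U' W a τ hnest ha hτ hvk ht hplaq hint htop (b s) hb.1 hb.2 hv
    rw [hdir s hs, hval s hs] at h
    simpa [hθdef, add_assoc] using h)
  have hθ0 : θ 0 = τ 0 + (7 * ((((((F.P K).d + 2) * (F.P K).L : ℕ) : ℝ) ^ 2 / 4) * a 0) + ((((F.P K).d + 1) * ((F.P K).L - 1) : ℕ) : ℝ) * τ 0) := by
    simp only [hθdef, if_pos (show 0 < k by omega)]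
  rw [hθ0] at hmain
  exact hmain

end Path

/-! ## §5  Folding the `d` runs of a staircase (n07-w8 g5's ask): the counts add, the `+1`s become `+d` -/

section Fold

/-- Floor division is superadditive over a finite sum: `Σ_κ (a_κ ∕ q) ≤ (Σ_κ a_κ) ∕ q` (Mathlib `Nat.add_div_le_add_div`, by induction). [folklore] -/
theorem sum_div_le_sum_div {ι : Type*} (s : Finset ι) (a : ι → ℕ) (q : ℕ) : ∑ κ ∈ s, a κ / q ≤ (∑ κ ∈ s, a κ) / q := by
  classical
  induction s using Finset.induction_on with
  | empty => simp
  | insert κ s hκ ih =>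
      rw [Finset.sum_insert hκ, Finset.sum_insert hκ]
      exact (Nat.add_le_add_left ih _).trans (Nat.add_div_le_add_div _ _ _)

/-- ★ **FOLDING THE RUNS**: for `d` straight runs of lengths `n_κ` (the coordinate runs of the corner staircase of p613291's `box_reach`, `D₀ := Σ_κ n_κ = Σ_κ (HI_κ − LO_κ)`) and non-negative level
increments `θ`, the per-run bounds of `sum_dist1_fine_path_le` add up to `D₀·θ₀ + Σ_{i<k} (D₀ ∕ L^{i+1} + d)·θ_{i+1}` — n07-w8 g5's «`N_i ≤ D₀ ∕ Lⁱ + d`». [folklore] -/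
theorem fold_runs_le {ι : Type*} (s : Finset ι) (nr : ι → ℕ) (L k : ℕ) (θ : ℕ → ℝ) (hθ : ∀ i ≤ k, 0 ≤ θ i) :
    ∑ κ ∈ s, ((nr κ : ℝ) * θ 0 + ∑ i ∈ Finset.range k, (((nr κ / L ^ (i + 1) + 1 : ℕ)) : ℝ) * θ (i + 1)) ≤
      ((∑ κ ∈ s, nr κ : ℕ) : ℝ) * θ 0 + ∑ i ∈ Finset.range k, ((((∑ κ ∈ s, nr κ) / L ^ (i + 1) + s.card : ℕ)) : ℝ) * θ (i + 1) := by
  classical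
  rw [Finset.sum_add_distrib, ← Finset.sum_mul, Finset.sum_comm]
  push_cast
  refine add_le_add le_rfl (Finset.sum_le_sum fun i hi => ?_)
  have hik : i + 1 ≤ k := by have := Finset.mem_range.1 hi; omega
  rw [← Finset.sum_mul]
  refine mul_le_mul_of_nonneg_right ?_ (hθ (i + 1) hik)
  -- `Σ_κ (n_κ ∕ q + 1) ≤ (Σ_κ n_κ) ∕ q + #s`
  have h := sum_div_le_sum_div s nr (L ^ (i + 1))
  rw [Finset.sum_add_distrib, Finset.sum_const, nsmul_eq_mul, mul_one]
  have h' : (∑ κ ∈ s, ((nr κ / L ^ (i + 1) : ℕ) : ℝ)) ≤ (((∑ κ ∈ s, nr κ) / L ^ (i + 1) : ℕ) : ℝ) := by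
    exact_mod_cast h
  linarith

end Fold

end Summit.QuantumFields.YangMills.BalabanUVNodes.N07FinePathCrossingCount
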